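import Summits.Ventures.CertifiedManyBodySolver.Statement
import Literature.MathematicalPhysics.QuantumLattice.HubbardSquareFreeFermionEnergyDensity

/-!
# M2 rows, part 13 — the FREE-FERMION (`U = 0`) control row and the free ENERGY FLOOR `-16/π²` at every `U ≥ 0`

HONEST FRAMING: first certified bounds; not a superconductivity verdict; every number certified or
labelled float.  This file adds NO certified number and NO Hubbard-`U` physics beyond the sign of the
repulsion: it turns the comparison table's `U = 0` CONTROL / ORIENTATION line (square lattice, `n = 1`,
thermodynamic limit; "a `U = 0` certificate excluding the free value is a pipeline bug") into tree
theorems BY NAME over the M2 row vocabulary of `Statement.lean` (`M2EnergyRow`, `M2EnergyLowerRow`,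
`M2EnergyUpperRow`, `M2Width`), using only the Literature facts
`FreeFermionSquare.energyDensity2D_one_zero_one` (`e(1, 0, 1) = -16/π²`, Hirsch §II eq. (2.2) in the
thermodynamic limit) and `FreeKinetic.energyDensity2D_ge` (the free Fermi sea is the kinetic minimum and
the repulsion is nonnegative; Lieb–Loss bathtub, Thm 8.2).

* §1 `energyDensity2D_zero_le` — for every real `t` and every `U ≥ 0`: `e(t, 0, 1) ≤ e(t, U, 1)`
  (repulsion only raises the half-filled ground-state energy density); at `t = 1`:
  `-16/π² ≤ e(1, U, 1)`, i.e. the THEOREM FLOOR `M2EnergyLowerRow U (-1.6212)` at every `U ≥ 0`.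
* §2 the `U = 0` row is DECIDED by the closed form: `M2EnergyRow 0 lo hi ↔ lo ≤ -16/π² ≤ hi`; the
  1e-4 window `M2EnergyRow 0 (-1.6212) (-1.6211)` holds and meets the M2 tolerance `M2Width` — the only
  `U` at which an M2-width two-sided row is a theorem today (and it is NOT a table cell: cells are
  `U/t ∈ {2, 4, 6, 8}`).
* §3 CONTROLS as refutations: an UPPER row below the free value is false at every `U ≥ 0`
  (`not_m2EnergyUpperRow_of_lt_free`), a LOWER row above it is false at `U = 0`.
* §4 the table's class-O orientation value for the nearest-neighbour spin correlation at `U = 0`,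
  `-(3/2)(e/8)² = -6/π⁴` with `e = -16/π²`, as PURE ARITHMETIC on the theorem's value — the Wick step
  `⟨𝐒₀·𝐒_{e₁}⟩(U=0) = -(3/2) g(e₁)²` is NOT formalised here (those comparators stay class O).

READING RULE (binding, as for the kinematic endpoints of part 11): the floor `-16/π² ≈ -1.6211` is a
THEOREM, certificate-free and physically nearly empty at `U ∈ {2,4,6,8}` (the table's CERTIFIED floors of
record, 2026-08-21, are `≈ -1.2468 / -0.9586 / -0.7570 / -0.6129` at `U = 2 / 4 / 6 / 8` — exact dyadic slots in
the certificate instances `Certificates.m2_U*_lower_r*_of`); it is never a "certified" endpoint, never enters an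
M2-width verdict, and a cell printed with it must label it "free floor (thm)".  (v1.1: v1.0's parenthesis quoted
rounded reference-scale values in place of the certified floors — corrected here; no declaration changed.)
-/

namespace Summit.Ventures.CertifiedManyBodySolver

open Literature.MathematicalPhysics.QuantumLattice
open Literature.MathematicalPhysics.QuantumLattice.ThermodynamicLimit

namespace M2

/-! ## §1 The free Fermi sea is an energy floor at every `U ≥ 0` -/

/-- **Repulsion only raises the energy.** For every real hopping `t` and every `U ≥ 0`, the half-filled
square-lattice ground-state energy density satisfies `e(t, 0, 1) ≤ e(t, U, 1)`: the free kinetic lower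
bound `FreeKinetic.energyDensity2D_ge` at chemical potential `μ = 0` is exactly the integral form of the
free value (`FreeFermionSquare.energyDensity2D_zero_one_eq_integral`).
[cite: LiebLoss1993, §8, Theorem 8.2] [cite: Hirsch1985, §II, eq. (2.2)] -/
theorem energyDensity2D_zero_le (t : ℝ) {U : ℝ} (hU : 0 ≤ U) :
    energyDensity2D t 0 1 ≤ energyDensity2D t U 1 := by
  have h := FreeKinetic.energyDensity2D_ge t hU zero_le_one one_lt_two 0
  simp only [sub_zero, zero_mul, zero_add] at h
  rwa [FreeFermionSquare.energyDensity2D_zero_one_eq_integral]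

/-- The free floor in closed form at `t = 1`: `-16/π² ≤ e(1, U, 1)` for every `U ≥ 0`.
[cite: Hirsch1985, §II, eq. (2.2)] [cite: LiebLoss1993, §8, Theorem 8.2] -/
theorem free_le_energyDensity2D {U : ℝ} (hU : 0 ≤ U) :
    -16 / Real.pi ^ 2 ≤ energyDensity2D 1 U 1 := by
  rw [← FreeFermionSquare.energyDensity2D_one_zero_one]
  exact energyDensity2D_zero_le 1 hU

/-- **THEOREM FLOOR (free, certificate-free) at every `U ≥ 0`:** `M2EnergyLowerRow U (-1.6212)`.
Physically nearly empty at the table's `U`; labelled "free floor (thm)", never "certified".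
[cite: Hirsch1985, §II, eq. (2.2)] [cite: LiebLoss1993, §8, Theorem 8.2] -/
theorem m2EnergyLowerRow_free {U : ℝ} (hU : 0 ≤ U) : M2EnergyLowerRow U (-1.6212 : ℚ) := by
  unfold M2EnergyLowerRow
  have h := FreeFermionSquare.energyDensity2D_one_zero_one_mem_Ioo
  have hmono : energyDensity2D 1 0 1 ≤ energyDensity2D 1 U 1 := energyDensity2D_zero_le 1 hU
  have e : (((-1.6212 : ℚ)) : ℝ) = (-1.6212 : ℝ) := by norm_num
  rw [e]
  exact h.1.le.trans hmono

/-- Any rational floor at or below `-1.6212` is a (free, theorem) lower row at every `U ≥ 0`. -/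
theorem m2EnergyLowerRow_free_of_le {U : ℝ} (hU : 0 ≤ U) {lo : ℚ} (hlo : lo ≤ (-1.6212 : ℚ)) :
    M2EnergyLowerRow U lo := by
  unfold M2EnergyLowerRow
  have h := m2EnergyLowerRow_free hU
  unfold M2EnergyLowerRow at h
  exact (by exact_mod_cast hlo : ((lo : ℚ) : ℝ) ≤ (((-1.6212 : ℚ)) : ℝ)).trans h

/-! ## §2 The `U = 0` row is decided by the closed form -/

/-- At `U = 0` the two-sided M2 energy row is DECIDED by the closed form `e(1, 0, 1) = -16/π²`:
`M2EnergyRow 0 lo hi ↔ lo ≤ -16/π² ∧ -16/π² ≤ hi`. [cite: Hirsch1985, §II, eq. (2.2)] -/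
theorem m2EnergyRow_zero_iff (lo hi : ℚ) :
    M2EnergyRow 0 lo hi ↔ ((lo : ℚ) : ℝ) ≤ -16 / Real.pi ^ 2 ∧ -16 / Real.pi ^ 2 ≤ ((hi : ℚ) : ℝ) := by
  rw [M2EnergyRow, FreeFermionSquare.energyDensity2D_one_zero_one]

/-- `M2EnergyLowerRow 0 lo ↔ lo ≤ -16/π²`. [cite: Hirsch1985, §II, eq. (2.2)] -/
theorem m2EnergyLowerRow_zero_iff (lo : ℚ) :
    M2EnergyLowerRow 0 lo ↔ ((lo : ℚ) : ℝ) ≤ -16 / Real.pi ^ 2 := by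
  rw [M2EnergyLowerRow, FreeFermionSquare.energyDensity2D_one_zero_one]

/-- `M2EnergyUpperRow 0 hi ↔ -16/π² ≤ hi`. [cite: Hirsch1985, §II, eq. (2.2)] -/
theorem m2EnergyUpperRow_zero_iff (hi : ℚ) :
    M2EnergyUpperRow 0 hi ↔ -16 / Real.pi ^ 2 ≤ ((hi : ℚ) : ℝ) := by
  rw [M2EnergyUpperRow, FreeFermionSquare.energyDensity2D_one_zero_one]

/-- **The `U = 0` control row (UNCONDITIONAL, width 1e-4):** `M2EnergyRow 0 (-1.6212) (-1.6211)`, from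
the tree's numerical window `-1.6212 < -16/π² < -1.6211`.  NOT a table cell (cells are
`U/t ∈ {2,4,6,8}`); an orientation / pipeline-control value, exact by theorem.
[cite: Hirsch1985, §II, eq. (2.2)] -/
theorem m2EnergyRow_zero_free : M2EnergyRow 0 (-1.6212 : ℚ) (-1.6211 : ℚ) := by
  have h := FreeFermionSquare.energyDensity2D_one_zero_one_mem_Ioo
  refine ⟨?_, ?_⟩
  · show (((-1.6212 : ℚ)) : ℝ) ≤ energyDensity2D 1 0 1
    have e : (((-1.6212 : ℚ)) : ℝ) = (-1.6212 : ℝ) := by norm_num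
    rw [e]; exact h.1.le
  · show energyDensity2D 1 0 1 ≤ (((-1.6211 : ℚ)) : ℝ)
    have e : (((-1.6211 : ℚ)) : ℝ) = (-1.6211 : ℝ) := by norm_num
    rw [e]; exact h.2.le

/-- The `U = 0` control window meets the M2 tolerance of record (`hi - lo ≤ 1/50`): the ONLY `U` at which
an M2-width two-sided energy row is a theorem today — and it is not a table cell. -/
theorem m2Width_zero_free : M2Width (-1.6212 : ℚ) (-1.6211 : ℚ) := by
  unfold M2Width; norm_num

/-! ## §3 Controls as refutations ("a certificate excluding the free value is a pipeline bug") -/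

/-- At every `U ≥ 0` an UPPER energy row strictly below the free value `-16/π²` is FALSE (the free Fermi
sea is a floor, §1): the Lean form of the table's `U = 0` pipeline control, valid at all table `U`.
[cite: LiebLoss1993, §8, Theorem 8.2] [cite: Hirsch1985, §II, eq. (2.2)] -/
theorem not_m2EnergyUpperRow_of_lt_free {U : ℝ} (hU : 0 ≤ U) {hi : ℚ}
    (h : ((hi : ℚ) : ℝ) < -16 / Real.pi ^ 2) : ¬ M2EnergyUpperRow U hi := by
  intro hrow
  unfold M2EnergyUpperRow at hrow
  exact absurd (hrow.trans_lt h) (not_lt.2 (free_le_energyDensity2D hU))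

/-- In particular any upper row at or below `-1.6212` is false at every `U ≥ 0`. -/
theorem not_m2EnergyUpperRow_of_le {U : ℝ} (hU : 0 ≤ U) {hi : ℚ} (h : hi ≤ (-1.6212 : ℚ)) :
    ¬ M2EnergyUpperRow U hi := by
  refine not_m2EnergyUpperRow_of_lt_free hU ?_
  have hw := FreeFermionSquare.energyDensity2D_one_zero_one_mem_Ioo
  rw [FreeFermionSquare.energyDensity2D_one_zero_one, Set.mem_Ioo] at hw
  have e : ((hi : ℚ) : ℝ) ≤ (-1.6212 : ℝ) := by
    have : (((-1.6212 : ℚ)) : ℝ) = (-1.6212 : ℝ) := by norm_num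
    rw [← this]; exact_mod_cast h
  exact e.trans_lt hw.1

/-- At `U = 0` a LOWER energy row strictly above the free value is FALSE.
[cite: Hirsch1985, §II, eq. (2.2)] -/
theorem not_m2EnergyLowerRow_zero_of_free_lt {lo : ℚ} (h : -16 / Real.pi ^ 2 < ((lo : ℚ) : ℝ)) :
    ¬ M2EnergyLowerRow 0 lo := by
  rw [m2EnergyLowerRow_zero_iff]
  exact not_le.2 h

/-- In particular any lower row at or above `-1.6211` is false at `U = 0`. -/
theorem not_m2EnergyLowerRow_zero_of_le {lo : ℚ} (h : (-1.6211 : ℚ) ≤ lo) :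
    ¬ M2EnergyLowerRow 0 lo := by
  refine not_m2EnergyLowerRow_zero_of_free_lt ?_
  have hw := FreeFermionSquare.energyDensity2D_one_zero_one_mem_Ioo
  rw [FreeFermionSquare.energyDensity2D_one_zero_one, Set.mem_Ioo] at hw
  have e : (-1.6211 : ℝ) ≤ ((lo : ℚ) : ℝ) := by
    have : (((-1.6211 : ℚ)) : ℝ) = (-1.6211 : ℝ) := by norm_num
    rw [← this]; exact_mod_cast h
  exact hw.2.trans_le e

/-! ## §4 The class-O orientation value `-6/π⁴` (pure arithmetic on the theorem's value) -/

/-- The table's `U = 0` orientation value for the O(U²) nearest-neighbour spin-correlation coefficient,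
`-(3/2) (e/8)² = -6/π⁴` with `e = -16/π²`: PURE ARITHMETIC on the value of
`FreeFermionSquare.energyDensity2D_one_zero_one`; the Wick identity behind it is NOT formalised (the
comparators using it stay class O, "exact by hand"). -/
theorem freeOrientation_spinNN_coeff :
    -(3 / 2 : ℝ) * ((-16 / Real.pi ^ 2) / 8) ^ 2 = -6 / Real.pi ^ 4 := by
  ring

end M2

end Summit.Ventures.CertifiedManyBodySolver
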